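import Mathlib
import HarnessLib
import HarnessLib.Audit

/-!
# HEX-MS: a Marica–Schönheim-type conjecture for antipodal ℤ₆-labelled set families (the pure core of Conjecture K♯)

Support file for crux `stmt-CriticalPhenomena-4575` (`NoHeavyLowerTail`, route `PercNearOneGluingNoHeavy`), hull-port seat `prim-hp-7`
(generation 64); `--supports stmt-CriticalPhenomena-4575`.  No `sorry`.  Memo: `run/shared/lean/prim/prim-hp-7/FROM-prim-hp-7-g64-HEXMS.md`.

**Setting.**  A finite family `𝒟` of subsets of a finite type, closed under complementation (`univ \ a ∈ 𝒟` for `a ∈ 𝒟`), and an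
ANTIPODAL labelling `x : Finset α → ZMod 6` (`x (univ \ a) = x a + 3` on `𝒟`; think of the six vertices of a hexagon and the antipodal map).
Two labels are CLOSE if their cyclic distance is at most one.  The GENERATED family is
`gen 𝒟 x = {a \ b : a, b ∈ 𝒟, x a close to x b}`.

* `HexMS` — **Conjecture HEX-MS** (hp-7 g64): `#𝒟 ≤ 2 · #(gen 𝒟 x)`, i.e. the generated differences number at least the complementary
  PAIRS of `𝒟`.  For labels on ONE antipodal axis (`{i, i+3}`) this is exactly the Marica–Schönheim inequality `#E ≤ #(E \\ E)`
  (Mathlib `Finset.card_le_card_diffs`) for the half `E = {a ∈ 𝒟 : x a = i}`; for two adjacent axes it is Marica–Schönheim for the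
  'merged' half `{x a ∈ {i, i+1}}` — both proved below (`hexMSAt_of_adjacent`).  Three axes is NEW: verified exhaustively for all
  5,764,801 antipodal labellings of `2^[4]` and all 2,401 of `2^[3]` (0 failures, 70,338 tight at n = 4), by annealing/random search for
  n = 5, 6, exact SAT census n ≤ 7 submitted (kit j189037); it is FALSE for labels on the 2-sphere, for arbitrary two-graphs and for
  long unit-interval closeness (memo §5), so the planar/cyclic structure is essential.
* Why it matters: for a monotone map `c : 2^[n] → 𝓗` (hexagon lattice; the free form of hp-7's Conjecture K♯ = PS₃, file
  `…PairedSunflowerConjecture`), if `q, s` are debtor sets with `c q ∨ c s = ⊤` and `c qᶜ ∧ c sᶜ = ⊥` then every `w ⊇ q ∪ s` is a donor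
  (memo Lemma A); for debtor sets carrying vertex ('pure') labels this linking condition is exactly closeness of the antipodal vertex
  labels, so HEX-MS ⟹ K♯ for every map whose debtor sets are pure, and the one-axis case is a 15-line proof of Kleitman's lemma
  from Marica–Schönheim.  The general (edge-labelled) case is the analogous statement MS♯ of the memo (exhaustive m = 4).
* `@[conjecture] ConjectureHexMS := HexMS` is an OBLIGATION of this programme, never used as a fact.
-/

namespace Summit.CriticalPhenomena.PercolationContinuityZ3.Theorems

namespace GeneratedDonors

open Finset FinsetFamily

/-- Closeness of two hexagon labels: cyclic distance at most one in `ZMod 6`. -/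
def Close (s t : ZMod 6) : Prop := s = t ∨ s = t + 1 ∨ t = s + 1

/-- Closeness is decidable. -/
instance : DecidableRel Close := fun s t => by unfold Close; infer_instance

section Defs

variable {α : Type*} [DecidableEq α]

/-- The generated family: differences `a \ b` of members with close labels. -/
def gen (𝒟 : Finset (Finset α)) (x : Finset α → ZMod 6) : Finset (Finset α) :=
  ((𝒟 ×ˢ 𝒟).filter fun p => Close (x p.1) (x p.2)).image fun p => p.1 \ p.2

/-- Membership in the generated family. -/
theorem mem_gen {𝒟 : Finset (Finset α)} {x : Finset α → ZMod 6} {d : Finset α} :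
    d ∈ gen 𝒟 x ↔ ∃ a ∈ 𝒟, ∃ b ∈ 𝒟, Close (x a) (x b) ∧ a \ b = d := by
  unfold gen
  constructor
  · intro h
    obtain ⟨p, hp, rfl⟩ := mem_image.mp h
    rw [mem_filter, mem_product] at hp
    exact ⟨p.1, hp.1.1, p.2, hp.1.2, hp.2, rfl⟩
  · rintro ⟨a, ha, b, hb, hc, rfl⟩
    exact mem_image.mpr ⟨(a, b), by rw [mem_filter, mem_product]; exact ⟨⟨ha, hb⟩, hc⟩, rfl⟩

end Defs

/-- **HEX-MS at one configuration**: if `𝒟` is closed under complement and `x` is antipodal on `𝒟`, the generated differences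
number at least half of `𝒟` (i.e. at least the number of complementary pairs). -/
def HexMSAt {α : Type*} [Fintype α] [DecidableEq α] (𝒟 : Finset (Finset α)) (x : Finset α → ZMod 6) : Prop :=
  (∀ a ∈ 𝒟, univ \ a ∈ 𝒟) → (∀ a ∈ 𝒟, x (univ \ a) = x a + 3) → #𝒟 ≤ 2 * #(gen 𝒟 x)

/-- **Conjecture HEX-MS** (hp-7 g64): `HexMSAt` for every finite type, family and antipodal labelling.  An obligation, not a fact. -/
def HexMS : Prop :=
  ∀ (α : Type) [Fintype α] [DecidableEq α] (𝒟 : Finset (Finset α)) (x : Finset α → ZMod 6), HexMSAt 𝒟 x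

/-- **CONJECTURE HEX-MS** as a typed obligation (exhaustive n ≤ 4; SAT census n ≤ 7 pending; memo FROM-prim-hp-7-g64-HEXMS.md).
[this work; obligation] -/
@[conjecture] def ConjectureHexMS : Prop := HexMS

section Adjacent

variable {α : Type*} [Fintype α] [DecidableEq α]

/-- Labels in an adjacent pair are close. -/
theorem close_of_mem_pair {i s t : ZMod 6} (hs : s = i ∨ s = i + 1) (ht : t = i ∨ t = i + 1) : Close s t := by
  unfold Close
  rcases hs with rfl | rfl <;> rcases ht with rfl | rfl
  · exact Or.inl rfl
  · exact Or.inr (Or.inr rfl)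
  · exact Or.inr (Or.inl rfl)
  · exact Or.inl rfl

/-- **HEX-MS holds when the labels use at most two ADJACENT antipodal axes** (`x a ∈ {i, i+1, i+3, i+4}` on `𝒟`): then the half
`E = {a ∈ 𝒟 : x a ∈ {i, i+1}}` consists of pairwise close members, `E \\ E ⊆ gen 𝒟 x`, complementation is a bijection `E → 𝒟 \ E`,
and the Marica–Schönheim inequality `#E ≤ #(E \\ E)` finishes.  (One axis = Kleitman's lemma via memo Lemma A; two axes = PS₂.) -/
theorem hexMSAt_of_adjacent (𝒟 : Finset (Finset α)) (x : Finset α → ZMod 6) (i : ZMod 6)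
    (hlab : ∀ a ∈ 𝒟, x a = i ∨ x a = i + 1 ∨ x a = i + 3 ∨ x a = i + 4) : HexMSAt 𝒟 x := by
  intro hcompl hanti
  classical
  set E : Finset (Finset α) := 𝒟.filter fun a => x a = i ∨ x a = i + 1 with hE
  -- E \\ E ⊆ gen
  have hsub : E \\ E ⊆ gen 𝒟 x := by
    rw [diffs_subset_iff]
    intro a ha b hb
    rw [hE, mem_filter] at ha hb
    exact mem_gen.mpr ⟨a, ha.1, b, hb.1, close_of_mem_pair ha.2 hb.2, rfl⟩
  have hMS : #E ≤ #(E \\ E) := E.card_le_card_diffs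
  have hgen : #E ≤ #(gen 𝒟 x) := hMS.trans (card_le_card hsub)
  -- complementation maps E into 𝒟 \ E injectively, and 𝒟 \ E into E
  have hcc : ∀ a : Finset α, univ \ (univ \ a) = a := fun a => by
    rw [Finset.sdiff_sdiff_eq_self (subset_univ a)]
  have key : ∀ j s : ZMod 6, (s = j + 3 ∨ s = j + 4) → (s + 3 = j ∨ s + 3 = j + 1) := by decide
  have himg : (𝒟 \ E) ⊆ E.image fun a => univ \ a := by
    intro b hb
    rw [mem_sdiff] at hb
    obtain ⟨hbD, hbE⟩ := hb
    have hcb : univ \ b ∈ 𝒟 := hcompl b hbD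
    have hxb : x (univ \ b) = x b + 3 := hanti b hbD
    -- x b ∉ {i, i+1}, so x b ∈ {i+3, i+4}, so x (univ \ b) ∈ {i, i+1}
    have hb' : ¬ (x b = i ∨ x b = i + 1) := fun h => hbE (by rw [hE, mem_filter]; exact ⟨hbD, h⟩)
    have hxcb : x (univ \ b) = i ∨ x (univ \ b) = i + 1 := by
      rw [hxb]
      rcases hlab b hbD with h | h | h | h
      · exact absurd (Or.inl h) hb'
      · exact absurd (Or.inr h) hb'
      · exact key i (x b) (Or.inl h)
      · exact key i (x b) (Or.inr h)
    refine mem_image.mpr ⟨univ \ b, ?_, hcc b⟩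
    rw [hE, mem_filter]
    exact ⟨hcb, hxcb⟩
  have hcard_compl : #(𝒟 \ E) ≤ #E := (card_le_card himg).trans card_image_le
  have hsplit : #𝒟 = #E + #(𝒟 \ E) := by
    rw [← card_union_of_disjoint (disjoint_sdiff), union_sdiff_of_subset (filter_subset _ _)]
  omega

/-- One antipodal axis (`x a ∈ {i, i+3}` on `𝒟`): HEX-MS is the Marica–Schönheim inequality. -/
theorem hexMSAt_of_oneAxis (𝒟 : Finset (Finset α)) (x : Finset α → ZMod 6) (i : ZMod 6)
    (hlab : ∀ a ∈ 𝒟, x a = i ∨ x a = i + 3) : HexMSAt 𝒟 x :=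
  hexMSAt_of_adjacent 𝒟 x i fun a ha => (hlab a ha).elim Or.inl fun h => Or.inr (Or.inr (Or.inl h))

end Adjacent

section EmptyMember

variable {α : Type*} [Fintype α] [DecidableEq α]

/-- Of two antipodal hexagon labels `s` and `s + 3`, at least one is close to any given label `t`. -/
theorem close_or_close_add_three (s t : ZMod 6) : Close s t ∨ Close (s + 3) t := by
  revert s t; decide

/-- **HEX-MS holds whenever `∅ ∈ 𝒟`** (equivalently `univ ∈ 𝒟`): the members whose label is close to `x ∅` form (at least) half of
`𝒟` — of `b` and `univ \ b` at least one is close to `x ∅` — and each such `a` is generated as `a \ ∅ = a`.  More generally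
`#(gen 𝒟 x)` is at least the number of distinct `a \ b₀` over the members `a` close to a FIXED `b₀ ∈ 𝒟`; for `b₀ = ∅` no collisions
occur.  (So the conjecture is only hard for families without small or large members; memo §8.) -/
theorem hexMSAt_of_empty_mem (𝒟 : Finset (Finset α)) (x : Finset α → ZMod 6) (h0 : (∅ : Finset α) ∈ 𝒟) : HexMSAt 𝒟 x := by
  intro hcompl hanti
  classical
  set Ncl : Finset (Finset α) := 𝒟.filter fun a => Close (x a) (x ∅) with hN
  have hsub : Ncl ⊆ gen 𝒟 x := by
    intro a ha
    rw [hN, mem_filter] at ha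
    exact mem_gen.mpr ⟨a, ha.1, ∅, h0, ha.2, sdiff_empty⟩
  have hcc : ∀ a : Finset α, univ \ (univ \ a) = a := fun a => by
    rw [Finset.sdiff_sdiff_eq_self (subset_univ a)]
  have himg : (𝒟 \ Ncl) ⊆ Ncl.image fun a => univ \ a := by
    intro b hb
    rw [mem_sdiff] at hb
    obtain ⟨hbD, hbN⟩ := hb
    have hb' : ¬ Close (x b) (x ∅) := fun h => hbN (by rw [hN, mem_filter]; exact ⟨hbD, h⟩)
    have hclose : Close (x (univ \ b)) (x ∅) := by
      rw [hanti b hbD]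
      exact (close_or_close_add_three (x b) (x ∅)).resolve_left hb'
    refine mem_image.mpr ⟨univ \ b, ?_, hcc b⟩
    rw [hN, mem_filter]
    exact ⟨hcompl b hbD, hclose⟩
  have h1 : #(𝒟 \ Ncl) ≤ #Ncl := (card_le_card himg).trans card_image_le
  have h2 : #𝒟 = #Ncl + #(𝒟 \ Ncl) := by
    rw [← card_union_of_disjoint (disjoint_sdiff), union_sdiff_of_subset (filter_subset _ _)]
  have h3 : #Ncl ≤ #(gen 𝒟 x) := card_le_card hsub
  omega

end EmptyMember

end GeneratedDonors

end Summit.CriticalPhenomena.PercolationContinuityZ3.Theorems
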